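import Mathlib
import Summits.NavierStokesRegularity.NavierStokesRegularity.Theorems.L3TimeExponentPincerJawFullMorreyHolds
import HarnessLib.Audit
import HarnessLib

/-!
# Sequential `L³`-slowness of scaled-energy-Type-I (full-Morrey) frame solutions
# (route `L3TimeExponentPincer`, items `stmt-NavierStokesRegularity-19499` / child `-19139`; support file 6)

Support file (cell ns-regularity-ideate, seat p4, gen 4).  0 `sorry`, no definitions.

THEOREM J′ (unconditional, `L3TimeExponentPincerJawFullMorreyHolds.lintegral_six_lt_top_holds`) gives, for every
frame solution that is full-Morrey-Type-I near `T`, `∫_{T₂}^{T} ‖u(t)‖₃⁶ dt < ∞`.  Since `∫^{T} dt/(T-t) = ∞`,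
the integrand cannot dominate `c/(T-t)` on any final window:

* `lintegral_Ioo_const_div_sub_eq_top` — `∫_{a}^{T} c/(T-t) dt = ∞` (`a < T`, `c > 0`), from Mathlib's
  `intervalIntegrable_sub_inv_iff`;
* `exists_late_l3_six_lt_of_fullMorrey` — for every `c > 0` and every `T₃ < T` there is a time
  `t ∈ (max T₃ 0, T)` with `‖u(t)‖₃⁶ < c/(T-t)`;
* `exists_late_l3Slow_of_fullMorrey` — the same in the currency of the pace predicate `L3Slow` of
  `L3TimeExponentPincerPaceDichotomy` (`‖u(t)‖₃³ ≤ A/√(T-t)`): for EVERY `A > 0` the `L³`-Type-I pace inequality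
  holds at times arbitrarily close to `T`, i.e. `liminf_{t→T} √(T-t) ‖u(t)‖₃³ = 0` — on the full-Morrey class the
  `L³` norm is infinitely often SLOWER than any Type-I pace, although (Seregin 2012, tree
  `…SerrinEndpointRung.tendsto_eLpNorm_three_of_blowup`) it diverges at a blow-up.

Bearing: the child crux's line `pace` asks (stub 2, `stub_morreyTypeI_slow`) for the UNIFORM pace `L3Slow` on
the larger top-at-`T` Morrey class `MorreyTypeINear`; this file records what the Maz'ya-free J′ gives for free on
the full-Morrey sub-class: the pace inequality along a sequence of times, with arbitrarily small constant.
WHAT THIS IS NOT: not a claim about Navier–Stokes regularity; not the uniform statement of stub 2; no item closed.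
-/

noncomputable section

namespace Summit.NavierStokesRegularity.NavierStokesRegularity.Theorems.L3TimeExponentPincerFullMorreySequentialPace

open MeasureTheory Set Function Filter Metric Topology
open scoped ENNReal NNReal
open Literature.Analysis.FluidPDE
open Summit.NavierStokesRegularity.NavierStokesRegularity.Theorems.L3TimeExponentPincerJawFullMorrey
  (FullMorreyTypeINear)
open Summit.NavierStokesRegularity.NavierStokesRegularity.Theorems.L3TimeExponentPincerJawFullMorreyHolds
  (lintegral_six_lt_top_holds)

/-- `∫_{a}^{T} c/(T-t) dt = ∞` for `a < T` and `c > 0` (lower Lebesgue integral of `ofReal`). -/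
theorem lintegral_Ioo_const_div_sub_eq_top {a T c : ℝ} (haT : a < T) (hc : 0 < c) :
    ∫⁻ t in Ioo a T, ENNReal.ofReal (c / (T - t)) = ⊤ := by
  by_contra hne
  have hlt : ∫⁻ t in Ioo a T, ENNReal.ofReal (c / (T - t)) < ⊤ := lt_top_iff_ne_top.2 hne
  have hcont : ContinuousOn (fun t : ℝ => c / (T - t)) (Ioo a T) :=
    continuousOn_const.div (continuousOn_const.sub continuousOn_id) fun t ht => by
      have : t < T := ht.2
      exact sub_ne_zero.2 (ne_of_gt this)
  have hmeas : AEStronglyMeasurable (fun t : ℝ => c / (T - t)) (volume.restrict (Ioo a T)) :=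
    hcont.aestronglyMeasurable measurableSet_Ioo
  have hnn : 0 ≤ᵐ[volume.restrict (Ioo a T)] fun t : ℝ => c / (T - t) :=
    (ae_restrict_iff' measurableSet_Ioo).2 (Eventually.of_forall fun t ht =>
      div_nonneg hc.le (sub_nonneg.2 (le_of_lt ht.2)))
  have hint : IntegrableOn (fun t : ℝ => c / (T - t)) (Ioo a T) :=
    ⟨hmeas, (hasFiniteIntegral_iff_ofReal hnn).2 hlt⟩
  have hint2 : IntegrableOn (fun t : ℝ => (t - T)⁻¹) (Ioo a T) := by
    have h3 : IntegrableOn (fun t : ℝ => -(1 / c) * (c / (T - t))) (Ioo a T) := hint.const_mul _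
    refine h3.congr_fun (fun t ht => ?_) measurableSet_Ioo
    have hTt : T - t ≠ 0 := sub_ne_zero.2 (ne_of_gt ht.2)
    have htT : t - T ≠ 0 := sub_ne_zero.2 (ne_of_lt ht.2)
    field_simp
    ring
  have hint3 : IntervalIntegrable (fun t : ℝ => (t - T)⁻¹) volume a T := by
    rw [intervalIntegrable_iff_integrableOn_Ioo_of_le haT.le]
    exact hint2
  rcases intervalIntegrable_sub_inv_iff.1 hint3 with h | h
  · exact absurd h haT.ne
  · exact h right_mem_uIcc

/-- **Sequential smallness of `(T-t)‖u(t)‖₃⁶` on the full-Morrey class**: for a frame solution (classical on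
`[0,T)`, Leray–Hopf) that is full-Morrey-Type-I near `T`, for every `c > 0` and every `T₃ < T` there is a late
time `t ∈ (max T₃ 0, T)` with `‖u(t)‖₃⁶ < c/(T-t)`. -/
theorem exists_late_l3_six_lt_of_fullMorrey {ν T : ℝ} (hν : 0 < ν) (hT : 0 < T)
    {u : ℝ → (EuclideanSpace ℝ (Fin 3)) → (EuclideanSpace ℝ (Fin 3))} {p : ℝ → (EuclideanSpace ℝ (Fin 3)) → ℝ}
    (hcl : IsClassicalNSSolutionOn (Ico 0 T) ν 0 u p) (hLH : IsLerayHopfOn T ν 0 (u 0) u)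
    (hFM : FullMorreyTypeINear u T) {c : ℝ} (hc : 0 < c) {T₃ : ℝ} (hT₃ : T₃ < T) :
    ∃ t ∈ Ioo (max T₃ 0) T, eLpNorm (u t) 3 volume ^ (6 : ℝ) < ENNReal.ofReal (c / (T - t)) := by
  obtain ⟨T₂, hT₂, -, -, -, h6⟩ := lintegral_six_lt_top_holds hν hT hcl hLH hFM
  by_contra hcon
  simp only [not_exists, not_and, not_lt] at hcon
  set a : ℝ := max (max T₃ 0) T₂ with ha
  have haT : a < T := max_lt (max_lt hT₃ hT) hT₂.2
  have key : ∫⁻ t in Ioo a T, ENNReal.ofReal (c / (T - t)) ≤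
      ∫⁻ t in Ioo T₂ T, eLpNorm (u t) 3 volume ^ (6 : ℝ) :=
    calc ∫⁻ t in Ioo a T, ENNReal.ofReal (c / (T - t))
        ≤ ∫⁻ t in Ioo a T, eLpNorm (u t) 3 volume ^ (6 : ℝ) :=
          setLIntegral_mono' measurableSet_Ioo fun t ht =>
            hcon t ⟨lt_of_le_of_lt (le_max_left _ _) ht.1, ht.2⟩
      _ ≤ ∫⁻ t in Ioo T₂ T, eLpNorm (u t) 3 volume ^ (6 : ℝ) :=
          lintegral_mono_set (Ioo_subset_Ioo_left (le_max_right _ _))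
  rw [lintegral_Ioo_const_div_sub_eq_top haT hc, top_le_iff] at key
  exact absurd key h6.ne

/-- **Sequential `L³`-Type-I pace on the full-Morrey class**: for every `A > 0` and every `T₃ < T` there is a
late time `t ∈ (max T₃ 0, T)` at which the `L³`-slow inequality `‖u(t)‖₃³ < A/√(T-t)` holds (the shape of
`L3TimeExponentPincerPaceDichotomy.L3Slow`, along a sequence instead of on a window, with arbitrary constant). -/
theorem exists_late_l3Slow_of_fullMorrey {ν T : ℝ} (hν : 0 < ν) (hT : 0 < T)
    {u : ℝ → (EuclideanSpace ℝ (Fin 3)) → (EuclideanSpace ℝ (Fin 3))} {p : ℝ → (EuclideanSpace ℝ (Fin 3)) → ℝ}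
    (hcl : IsClassicalNSSolutionOn (Ico 0 T) ν 0 u p) (hLH : IsLerayHopfOn T ν 0 (u 0) u)
    (hFM : FullMorreyTypeINear u T) {A : ℝ} (hA : 0 < A) {T₃ : ℝ} (hT₃ : T₃ < T) :
    ∃ t ∈ Ioo (max T₃ 0) T,
      eLpNorm (u t) 3 volume ^ (3 : ℝ) < ENNReal.ofReal (A / Real.sqrt (T - t)) := by
  obtain ⟨t, ht, h6⟩ := exists_late_l3_six_lt_of_fullMorrey hν hT hcl hLH hFM (pow_pos hA 2) hT₃
  refine ⟨t, ht, ?_⟩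
  have hTt : 0 < T - t := sub_pos.2 ht.2
  -- `‖u‖₃⁶ = (‖u‖₃³)²` and `A²/(T-t) = (A/√(T-t))²`
  have h1 : eLpNorm (u t) 3 volume ^ (6 : ℝ) = (eLpNorm (u t) 3 volume ^ (3 : ℝ)) ^ 2 := by
    rw [← ENNReal.rpow_two, ← ENNReal.rpow_mul]; norm_num
  have h2 : ENNReal.ofReal (A ^ 2 / (T - t)) = ENNReal.ofReal (A / Real.sqrt (T - t)) ^ 2 := by
    rw [← ENNReal.ofReal_pow (by positivity)]
    congr 1
    rw [div_pow, Real.sq_sqrt hTt.le]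
  rw [h1, h2] at h6
  by_contra hle
  rw [not_lt] at hle
  exact absurd (pow_le_pow_left' hle 2) (not_le.2 h6)

end Summit.NavierStokesRegularity.NavierStokesRegularity.Theorems.L3TimeExponentPincerFullMorreySequentialPace

end
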